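import Mathlib
import HarnessLib
import Literature.Probability.MarkovChains.MetropolisHastings
import Summits.Ventures.LatticeQCDFlow.Exactness.JarzynskiFinite

/-!
# Independence Metropolis on path space over non-equilibrium evolutions is exact

HONEST FRAMING: exact (Metropolis-corrected) sampling algorithms for lattice gauge theory;
figures of merit are autocorrelation/cost numbers at stated couplings and volumes; no
continuum-physics claim.

Venture `LatticeQCDFlow` (cell pub-lqcd), topic `Exactness`; FANOUT row 13 (`eng-snf`, the
`latflow-snf` protocol engine, function `snf.estimators.path_imh_chain`: the second exact-chain
alternative to Jarzynski reweighting, next to tempered transitions).  NEW WORK of the cell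
(elementary finite sums), not a published result; the construction (Metropolis–Hastings moves in
the path space of a stochastic normalizing flow / non-equilibrium evolution, acceptance by the
ratio of path weights) is the one of H. Wu, J. Köhler, F. Noé, "Stochastic Normalizing Flows",
NeurIPS 2020 (arXiv:2002.06707), §3 (named only; nothing is cited as a fact).

## Content

A forward protocol on a finite configuration space: actions `S 0, …, S n`, kernels `P k` applied
after the switch `S k → S (k+1)` (conventions of `JarzynskiFinite.lean`: `work`, `transProb`).
A forward EVOLUTION is a path `x` drawn from the forward path weight
`fwd x = e^{-S 0 (x 0)} · transProb P x` (exact prior draw, then the protocol).  Path-space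
independence Metropolis (path-IMH) keeps a current path `x`, proposes a FRESH evolution `y`, and
accepts it with probability `min 1 e^{-(W y - W x)}`.

* `tiltedPathWeight S P x = fwd x · e^{-W x}` — the target weight on path space;
* `pathIMHMove_detailedBalance` — the accepted-move weights `fwd y · min 1 e^{-(W y - W x)}` are in
  detailed balance with the tilted weight (both sides equal `fwd x · fwd y · min (e^{-W x}) (e^{-W y})`);
  no positivity or normalisation is needed;
* `pathIMHKernel_detailedBalance`, `pathIMHKernel_sum_eq_one`, `pathIMHKernel_isStationary` —
  with the rejection mass on the diagonal this is a Markov kernel leaving the tilted path weight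
  invariant;
* `tiltedPathWeight_endpoint` — if every `P k` leaves `e^{-S (k+1)}` invariant, the END-POINT
  marginal of the tilted path weight is the target Boltzmann weight:
  `Σ_x tilted x · f (x n) = Σ_y e^{-S n y} · f y` (this is `jarzynski_observable`).
Hence the end points of the path-IMH chain sample `e^{-S n}/Z n` exactly — PROVIDED the proposals
are genuine forward evolutions from EXACT, INDEPENDENT prior draws (`fwd` is their law).  With
starts taken from a prior-side Markov chain the proposals are neither independent nor `fwd`-
distributed and the construction does not apply (latflow-snf README: "exact ONLY when the starts are
iid exact prior draws (2D U(1) open cut: yes; 4D: no)").  Irreducibility / convergence of the path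
chain is not addressed here (stationarity only).
-/

namespace Summit.Ventures.LatticeQCDFlow.Exactness

open Finset
open Literature.Probability.MarkovChains

variable {X : Type*} [Fintype X]

/-- Forward path weight of an evolution: exact prior weight of the start times the transition
probabilities, `e^{-S 0 (x 0)} · Π_k P k (x k) (x (k+1))` (unnormalised by `Z 0`). -/
noncomputable def fwdPathWeight {n : ℕ} (S : Fin (n + 1) → X → ℝ) (P : Fin n → X → X → ℝ)
    (x : Fin (n + 1) → X) : ℝ :=
  Real.exp (-S 0 (x 0)) * transProb P x

/-- The TILTED path weight `fwd x · e^{-W x}`: the target of path-space independence Metropolis. -/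
noncomputable def tiltedPathWeight {n : ℕ} (S : Fin (n + 1) → X → ℝ) (P : Fin n → X → X → ℝ)
    (x : Fin (n + 1) → X) : ℝ :=
  fwdPathWeight S P x * Real.exp (-work S x)

omit [Fintype X] in
/-- Forward path weights are non-negative for non-negative kernels. -/
theorem fwdPathWeight_nonneg {n : ℕ} (S : Fin (n + 1) → X → ℝ) {P : Fin n → X → X → ℝ}
    (hP : ∀ k a b, 0 ≤ P k a b) (x : Fin (n + 1) → X) : 0 ≤ fwdPathWeight S P x :=
  mul_nonneg (Real.exp_pos _).le (prod_nonneg fun k _ => hP k _ _)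

/-- The algebra of the independence-Metropolis ratio: `e^{-a} · min 1 e^{-(b - a)} = min e^{-a} e^{-b}`. -/
theorem exp_neg_mul_min_one (a b : ℝ) :
    Real.exp (-a) * min 1 (Real.exp (-(b - a))) = min (Real.exp (-a)) (Real.exp (-b)) := by
  rw [mul_min_of_nonneg _ _ (Real.exp_pos _).le, mul_one, ← Real.exp_add]
  congr 2
  ring

/-! ## The path-IMH kernel -/

/-- Accepted-move weight of path-IMH: propose the fresh evolution `y` (weight `fwd y`) and accept
it against the current path `x` with `min 1 e^{-(W y - W x)}`. -/
noncomputable def pathIMHMove {n : ℕ} (S : Fin (n + 1) → X → ℝ) (P : Fin n → X → X → ℝ)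
    (x y : Fin (n + 1) → X) : ℝ :=
  fwdPathWeight S P y * min 1 (Real.exp (-(work S y - work S x)))

omit [Fintype X] in
/-- **Detailed balance of path-IMH (accepted moves)** with respect to the tilted path weight:
`tilted x · M x y = tilted y · M y x`, both being `fwd x · fwd y · min (e^{-W x}) (e^{-W y})`. -/
theorem pathIMHMove_detailedBalance {n : ℕ} (S : Fin (n + 1) → X → ℝ) (P : Fin n → X → X → ℝ) :
    DetailedBalance (tiltedPathWeight S P) (pathIMHMove S P) := by
  intro x y
  unfold tiltedPathWeight pathIMHMove
  calc fwdPathWeight S P x * Real.exp (-work S x) *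
        (fwdPathWeight S P y * min 1 (Real.exp (-(work S y - work S x))))
      = fwdPathWeight S P x * fwdPathWeight S P y *
          (Real.exp (-work S x) * min 1 (Real.exp (-(work S y - work S x)))) := by ring
    _ = fwdPathWeight S P x * fwdPathWeight S P y *
          min (Real.exp (-work S x)) (Real.exp (-work S y)) := by rw [exp_neg_mul_min_one]
    _ = fwdPathWeight S P y * fwdPathWeight S P x *
          (Real.exp (-work S y) * min 1 (Real.exp (-(work S x - work S y)))) := by
        rw [exp_neg_mul_min_one, min_comm]; ring
    _ = fwdPathWeight S P y * Real.exp (-work S y) *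
        (fwdPathWeight S P x * min 1 (Real.exp (-(work S x - work S y)))) := by ring

section Kernel

variable [DecidableEq X]

/-- The full path-IMH kernel: accepted moves plus the rejection / no-move mass on the diagonal. -/
noncomputable def pathIMHKernel {n : ℕ} (S : Fin (n + 1) → X → ℝ) (P : Fin n → X → X → ℝ)
    (x y : Fin (n + 1) → X) : ℝ :=
  pathIMHMove S P x y + if y = x then 1 - ∑ z, pathIMHMove S P x z else 0

/-- **Path-IMH is in detailed balance with the tilted path weight** (any protocol, any kernels). -/
theorem pathIMHKernel_detailedBalance {n : ℕ} (S : Fin (n + 1) → X → ℝ) (P : Fin n → X → X → ℝ) :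
    DetailedBalance (tiltedPathWeight S P) (pathIMHKernel S P) := by
  intro x y
  unfold pathIMHKernel
  have hM := pathIMHMove_detailedBalance S P x y
  by_cases hxy : y = x
  · subst hxy
    rfl
  · have hyx : ¬x = y := fun h => hxy h.symm
    rw [if_neg hxy, if_neg hyx, add_zero, add_zero]
    exact hM

/-- The rows of the path-IMH kernel sum to one. -/
theorem pathIMHKernel_sum_eq_one {n : ℕ} (S : Fin (n + 1) → X → ℝ) (P : Fin n → X → X → ℝ)
    (x : Fin (n + 1) → X) : ∑ y, pathIMHKernel S P x y = 1 := by
  unfold pathIMHKernel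
  rw [sum_add_distrib, sum_ite_eq' univ x, if_pos (mem_univ x)]
  ring

/-- Hence the tilted path weight is invariant under path-IMH. -/
theorem pathIMHKernel_isStationary {n : ℕ} (S : Fin (n + 1) → X → ℝ) (P : Fin n → X → X → ℝ) :
    IsStationary (tiltedPathWeight S P) (pathIMHKernel S P) :=
  (pathIMHKernel_detailedBalance S P).isStationary (pathIMHKernel_sum_eq_one S P)

end Kernel

/-! ## The end-point marginal of the tilted path weight is the target -/

/-- **End-point marginal.**  If every kernel `P k` leaves `e^{-S (k+1)}` invariant, then for every
function `f` of the final configuration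
`Σ_x tilted x · f (x n) = Σ_y e^{-S n y} · f y`: the end points of tilted-distributed paths are
Boltzmann-distributed for the TARGET action (with total mass `Z n`).  This is Jarzynski's master
identity `jarzynski_observable`; combined with `pathIMHKernel_isStationary` it says that the end
points of a stationary path-IMH chain sample the target exactly. -/
theorem tiltedPathWeight_endpoint {n : ℕ} (S : Fin (n + 1) → X → ℝ) (P : Fin n → X → X → ℝ)
    (hP : ∀ k : Fin n, IsStationary (fun x => Real.exp (-S k.succ x)) (P k)) (f : X → ℝ) :
    ∑ x : Fin (n + 1) → X, tiltedPathWeight S P x * f (x (Fin.last n)) =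
      ∑ y, Real.exp (-S (Fin.last n) y) * f y := by
  unfold tiltedPathWeight fwdPathWeight
  exact jarzynski_observable S P hP f

/-- In particular the total mass of the tilted path weight is the TARGET partition function
`Z n = Σ_y e^{-S n y}` (Jarzynski: `E_fwd[e^{-W}] = Z n / Z 0`). -/
theorem sum_tiltedPathWeight {n : ℕ} (S : Fin (n + 1) → X → ℝ) (P : Fin n → X → X → ℝ)
    (hP : ∀ k : Fin n, IsStationary (fun x => Real.exp (-S k.succ x)) (P k)) :
    ∑ x : Fin (n + 1) → X, tiltedPathWeight S P x = partitionFn (S (Fin.last n)) := by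
  have h := tiltedPathWeight_endpoint S P hP fun _ => 1
  simp only [mul_one] at h
  rw [h]
  rfl

end Summit.Ventures.LatticeQCDFlow.Exactness
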